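import Mathlib
import Literature.NumberTheory.LFunctions.DirichletLValueBernoulli
import Literature.NumberTheory.LFunctions.RiemannSiegelChiStirling
import Literature.NumberTheory.LFunctions.RiemannSiegelChiBounds
import Literature.NumberTheory.LFunctions.RiemannSiegelChiLogDeriv
import HarnessLib

/-!
# Zhang (2022), §2 (2.3)–(2.5) and (5.5): the gamma factor `ϑ(s)` of the functional equation and
# the asymptotic root number `Z(s,θ) = θ(−1)τ(θ)k^{−s}ϑ(s)(1 + O(e^{−πt}))`, kernel-checked

Topic `Literature/NumberTheory/LFunctions/Zhang2022` (Landau–Siegel autopsy tree; verdict-neutral).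
Y. Zhang, *Discrete mean estimates and the Landau–Siegel zero*, arXiv:2211.02515v1 (2022) — **an
unrefereed manuscript, a claimed result under adjudication** (cell pub-zhang: audit + repair census
of arXiv:2211.02515; no claim about Landau–Siegel) — §2, p. 4:

> In case `θ (mod k)` is a primitive character, the functional equation for `L(s,θ)` is
> `L(s,θ) = Z(s,θ)L(1−s,θ̄)` (2.2), where
> `Z(s,θ) = τ(θ)π^{s−1/2}k^{−s}Γ((1−s)/2)Γ(s/2)⁻¹` if `θ(−1) = 1`, and
> `Z(s,θ) = −iτ(θ)π^{s−1/2}k^{−s}Γ((2−s)/2)Γ((1+s)/2)⁻¹` if `θ(−1) = −1`. When `t` is large, it is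
> convenient to use an asymptotic expression for `Z(s,θ)` as follows. Let
> `ϑ(s) = 2(2π)^{s−1}Γ(1−s) sin(πs/2)`                                                     (2.3)
> (this function is usually written as `χ(s)` in the literature). It is known that
> `π^{s−1/2}Γ((1−s)/2)Γ(s/2)⁻¹ = ϑ(s)` and `π^{s−1/2}Γ((2−s)/2)Γ((1+s)/2)⁻¹ = ϑ(s)cot(πs/2)`.
> Assume `t > 1`. Then `i cot(πs/2) = 1 + O(e^{−πt})`. Thus we have uniformly
> `Z(s,θ) = θ(−1)τ(θ)k^{−s}ϑ(s)(1 + O(e^{−πt}))`,                                          (2.4)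
> and `Z(s,θ)⁻¹ = τ(θ̄)k^{s−1}ϑ(1−s)(1 + O(e^{−πt}))`,                                      (2.5)
> the `O(e^{−πt})` term being identically zero in case `θ(−1) = 1`.

and §5, p. 10 (before (5.5)):

> It is known that `ϑ(1−s) = 2(2π)^{−s}Γ(s)cos(πs/2)`. For `t > 1` we have
> `ϑ(1−s) = ϑ*(1−s)(1 + O(e^{−πt}))`                                                       (5.5)
> where `ϑ*(1−s) = (2π)^{−s}Γ(s)e(−s/4)`.

(These feed (4.5)–(4.6), Lemmas 5.1–5.3 and (5.6)–(5.7).) This file PROVES every "It is known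
that" above and (2.4), (2.5), (5.5) as EXACT identities with explicit remainder terms:

* `vartheta` = (2.3); `vartheta_eq_Gammaℝ_div`: `ϑ(s) = Γ_ℝ(1−s)/Γ_ℝ(s)` (Mathlib's
  `Gammaℝ_div_Gammaℝ_one_sub`, i.e. reflection + duplication); `gammaQuotient_even_eq` (the first
  "It is known that"), `gammaQuotient_odd_eq` / `gammaQuotient_odd_eq_cot` (the second);
* `I_mul_cos_mul_eq` / `I_mul_cot_eq`: `i cot(πs/2) = (1+q)/(1−q)` with `q = e^{iπs}`,
  `|q| = e^{−πt}` (`norm_qexp`); `norm_I_mul_cot_sub_one_le`: for `t > 0`,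
  `|i cot(πs/2) − 1| ≤ 2e^{−πt}/(1 − e^{−πt})`, and `≤ 3e^{−πt}` for `t ≥ 1`
  (the printed "`i cot(πs/2) = 1 + O(e^{−πt})`");
* `vartheta_one_sub` (the §5 "It is known that"), `vartheta_one_sub_eq_star_mul`:
  `ϑ(1−s) = ϑ*(1−s)·(1 + q)` EXACTLY — (5.5) with the `O`-term `= ϑ*(1−s)q`, `|q| = e^{−πt}`;
* `vartheta_mul_vartheta_one_sub`: `ϑ(s)ϑ(1−s) = 1` (`s ∉ ℤ`);
* `Zfac` = the printed `Z(s,θ)` (`τ(θ)` = Mathlib's `gaussSum θ stdAddChar`); `Zfac_eq_even`,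
  `Zfac_eq_odd`: (2.4) EXACTLY — `Z(s,θ) = θ(−1)τ(θ)k^{−s}ϑ(s)·(1 + r)` with `r = 0` (even `θ`)
  resp. `r = i cot(πs/2) − 1` (odd `θ`), `|r| ≤ 3e^{−πt}` for `t ≥ 1`;
  `Zfac_inv_eq`: (2.5) EXACTLY — `Z(s,θ)⁻¹ = τ(θ̄)k^{s−1}ϑ(1−s)·(1+r)⁻¹` for primitive `θ`
  (uses `τ(θ)τ(θ̄) = θ(−1)k`, the tree's `gaussSum_mul_gaussSum_inv`, and `ϑ(s)ϑ(1−s) = 1`),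
  with `|(1+r)⁻¹ − 1| ≤ 6e^{−πt}` for `t ≥ 1` (`norm_inv_one_add_corr_sub_one_le`);
* `vartheta_eq_rsChi`: `ϑ = χ` of the tree (`SiegelIntegral.rsChi`, Titchmarsh's `χ(s)`) off the real
  axis — so the tree's Stirling formula `rsChi_stirling` (Titchmarsh (4.12.3)) applies to Zhang's `ϑ`.

Hypotheses are the honest ones for pointwise identities between meromorphic functions (`s` off
the relevant poles / `t = Im s > 0`); the manuscript uses them for `t ≍ t₀` large. The functional
equation (2.2) itself is classical and is not restated here. Nothing about Theorems 1–2 of the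
source is stated or implied; nothing here bears on the cell's verdict on (8.24).

## References

* Y. Zhang, arXiv:2211.02515v1 (2022), §2 p. 4 (2.2)–(2.5); §5 p. 10 (5.5).
  [cite: Zhang2022LandauSiegel, §2 (2.3)–(2.5); §5 (5.5)]
* E. C. Titchmarsh, *The Theory of the Riemann Zeta-Function*, 2nd ed. revised by
  D. R. Heath-Brown (OUP 1986), §2.1 p. 16: (2.1.10)
  `χ(s) = 2^s π^{s−1} sin(½sπ) Γ(1−s) = π^{s−½} Γ(½−½s)/Γ(½s)` (= Zhang's first "It is known
  that", with `2^sπ^{s−1} = 2(2π)^{s−1}`) and (2.1.11) `χ(s)χ(1−s) = 1`.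
  [cite: Titchmarsh1986, §2.1 (2.1.10)–(2.1.11)]
-/

noncomputable section

open Complex Real

namespace Literature.NumberTheory.LFunctions.Zhang2022.GammaFactor

/-! ### §1. `ϑ(s)` (2.3) and the two gamma-quotient identities -/

/-- **(2.3)** `ϑ(s) = 2(2π)^{s−1}Γ(1−s)sin(πs/2)` ("usually written as `χ(s)`").
[cite: Zhang2022LandauSiegel, §2 (2.3)] -/
def vartheta (s : ℂ) : ℂ :=
  2 * (2 * π : ℂ) ^ (s - 1) * Complex.Gamma (1 - s) * Complex.sin (π * s / 2)

/-- The §5 form: `ϑ(1−s) = 2(2π)^{−s}Γ(s)cos(πs/2)` ("It is known that").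
[cite: Zhang2022LandauSiegel, §5 before (5.5)] -/
theorem vartheta_one_sub (s : ℂ) :
    vartheta (1 - s) = 2 * (2 * π : ℂ) ^ (-s) * Complex.Gamma s * Complex.cos (π * s / 2) := by
  rw [vartheta, sub_sub_cancel, show (1 : ℂ) - s - 1 = -s by ring,
    show (π : ℂ) * (1 - s) / 2 = π / 2 - π * s / 2 by ring, Complex.sin_pi_div_two_sub]

/-- `ϑ(s) = Γ_ℝ(1−s)/Γ_ℝ(s)` with Deligne's `Γ_ℝ(s) = π^{−s/2}Γ(s/2)` (reflection + duplication,
Mathlib's `Gammaℝ_div_Gammaℝ_one_sub`), off the poles `s = 2, 4, 6, …` of `Γ(1−s)sin(πs/2)`'s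
partner. [cite: Titchmarsh1986, §2.1 (2.1.10)] -/
theorem vartheta_eq_Gammaℝ_div {s : ℂ} (hs : ∀ n : ℕ, s ≠ 2 * n + 2) :
    vartheta s = Gammaℝ (1 - s) / Gammaℝ s := by
  have h : ∀ n : ℕ, (1 - s) ≠ -(2 * (n : ℂ) + 1) := by
    intro n hn
    exact hs n (by linear_combination -hn)
  have key := Gammaℝ_div_Gammaℝ_one_sub h
  rw [sub_sub_cancel] at key
  rw [key, Gammaℂ_def, vartheta, show (π : ℂ) * (1 - s) / 2 = π / 2 - π * s / 2 by ring,
    Complex.cos_pi_div_two_sub, show -((1 : ℂ) - s) = s - 1 by ring]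

/-- **Bridge to the tree**: off the real axis Zhang's `ϑ` IS the tree's `χ`
(`SiegelIntegral.rsChi (s) = (2π)^s/(2Γ(s)cos(πs/2))`, Titchmarsh (2.1.8)–(2.1.10)), so e.g. the
tree's Stirling formula `rsChi_stirling` / `rsChi_stirling_of_abs_le` and `rsChi_mul_rsChi_one_sub`
apply to `ϑ`. [cite: Titchmarsh1986, §2.1 (2.1.10)] -/
theorem vartheta_eq_rsChi {s : ℂ} (hs : s.im ≠ 0) : vartheta s = SiegelIntegral.rsChi s := by
  have h1 : ∀ n : ℕ, s ≠ 2 * n + 2 := by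
    intro n h
    have := congrArg Complex.im h
    simp at this
    exact hs this
  have h2 : ∀ n : ℕ, s ≠ -(2 * (n : ℂ) + 1) := by
    intro n h
    have := congrArg Complex.im h
    simp at this
    exact hs this
  rw [vartheta_eq_Gammaℝ_div h1, ChiStirling.rsChi_eq_Gammaℝ_div s h2]

/-- **The first "It is known that"**: `π^{s−1/2}Γ((1−s)/2)Γ(s/2)⁻¹ = ϑ(s)` (for `s ≠ 2, 4, 6, …`)
— Titchmarsh's (2.1.10). [cite: Zhang2022LandauSiegel, §2 after (2.3)]
[cite: Titchmarsh1986, §2.1 (2.1.10)] -/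
theorem gammaQuotient_even_eq {s : ℂ} (hs : ∀ n : ℕ, s ≠ 2 * n + 2) :
    (π : ℂ) ^ (s - 1 / 2) * Complex.Gamma ((1 - s) / 2) * (Complex.Gamma (s / 2))⁻¹
      = vartheta s := by
  have hπ : (π : ℂ) ≠ 0 := ofReal_ne_zero.mpr Real.pi_ne_zero
  rw [vartheta_eq_Gammaℝ_div hs, Gammaℝ_def, Gammaℝ_def,
    show (π : ℂ) ^ (s - 1 / 2) = (π : ℂ) ^ (-(1 - s) / 2) / (π : ℂ) ^ (-s / 2) by
      rw [← cpow_sub _ _ hπ]; congr 1; ring]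
  ring

/-- **The second "It is known that"**, division-free form:
`π^{s−1/2}Γ((2−s)/2)Γ((1+s)/2)⁻¹ = 2(2π)^{s−1}Γ(1−s)cos(πs/2)` (`= ϑ(s)cot(πs/2)`), for
`s ≠ 1, 2, 3, …`. [cite: Zhang2022LandauSiegel, §2 after (2.3)] -/
theorem gammaQuotient_odd_eq {s : ℂ} (hs : ∀ n : ℕ, s ≠ n + 1) :
    (π : ℂ) ^ (s - 1 / 2) * Complex.Gamma ((2 - s) / 2) * (Complex.Gamma ((1 + s) / 2))⁻¹
      = 2 * (2 * π : ℂ) ^ (s - 1) * Complex.Gamma (1 - s) * Complex.cos (π * s / 2) := by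
  have hπ : (π : ℂ) ≠ 0 := ofReal_ne_zero.mpr Real.pi_ne_zero
  have h : ∀ n : ℕ, (1 - s) ≠ -(n : ℂ) := by
    intro n hn
    exact hs n (by linear_combination -hn)
  have hne : Gammaℝ (2 - s) ≠ 0 := by
    rw [Ne, Gammaℝ_eq_zero_iff, not_exists]
    intro m hm
    apply hs (2 * m + 1)
    push_cast
    linear_combination -hm
  have key : Gammaℝ (2 - s) * (Gammaℝ (1 + s))⁻¹
      = Gammaℂ (1 - s) * Complex.sin (π * (1 - s) / 2) := by
    have k := inv_Gammaℝ_two_sub h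
    rw [show (2 : ℂ) - (1 - s) = 1 + s by ring, show (1 : ℂ) - s + 1 = 2 - s by ring] at k
    rw [k]
    field_simp
  rw [Gammaℝ_def, Gammaℝ_def, Gammaℂ_def, mul_inv, ← cpow_neg] at key
  calc (π : ℂ) ^ (s - 1 / 2) * Complex.Gamma ((2 - s) / 2) * (Complex.Gamma ((1 + s) / 2))⁻¹
      = (π : ℂ) ^ (-(2 - s) / 2) * Complex.Gamma ((2 - s) / 2)
          * ((π : ℂ) ^ (-(-(1 + s) / 2)) * (Complex.Gamma ((1 + s) / 2))⁻¹) := by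
        rw [show (π : ℂ) ^ (s - 1 / 2) = (π : ℂ) ^ (-(2 - s) / 2) * (π : ℂ) ^ (-(-(1 + s) / 2)) by
          rw [← cpow_add _ _ hπ]; congr 1; ring]
        ring
    _ = 2 * (2 * π : ℂ) ^ (-(1 - s)) * Complex.Gamma (1 - s) * Complex.sin (π * (1 - s) / 2) := key
    _ = 2 * (2 * π : ℂ) ^ (s - 1) * Complex.Gamma (1 - s) * Complex.cos (π * s / 2) := by
        rw [show -((1 : ℂ) - s) = s - 1 by ring,
          show (π : ℂ) * (1 - s) / 2 = π / 2 - π * s / 2 by ring, Complex.sin_pi_div_two_sub]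

/-- **The second "It is known that"** as printed: `π^{s−1/2}Γ((2−s)/2)Γ((1+s)/2)⁻¹ = ϑ(s)cot(πs/2)`
(for `s ≠ 1, 2, 3, …` with `sin(πs/2) ≠ 0`). [cite: Zhang2022LandauSiegel, §2 after (2.3)] -/
theorem gammaQuotient_odd_eq_cot {s : ℂ} (hs : ∀ n : ℕ, s ≠ n + 1)
    (hsin : Complex.sin (π * s / 2) ≠ 0) :
    (π : ℂ) ^ (s - 1 / 2) * Complex.Gamma ((2 - s) / 2) * (Complex.Gamma ((1 + s) / 2))⁻¹
      = vartheta s * (Complex.cos (π * s / 2) / Complex.sin (π * s / 2)) := by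
  rw [gammaQuotient_odd_eq hs, vartheta]
  field_simp

/-! ### §2. `i cot(πs/2) = 1 + O(e^{−πt})` -/

/-- `q = e^{iπs}`. [folklore] -/
def qexp (s : ℂ) : ℂ := cexp (π * s * I)

/-- `|q| = e^{−πt}`. [folklore] -/
theorem norm_qexp (s : ℂ) : ‖qexp s‖ = Real.exp (-π * s.im) := by
  rw [qexp, Complex.norm_exp]
  congr 1
  simp [Complex.mul_re, Complex.mul_im]

/-- The exponential identity behind "`i cot(πs/2) = 1 + O(e^{−πt})`", division-free:
`i cos(πs/2)(1 − q) = sin(πs/2)(1 + q)`, `q = e^{iπs}`. [folklore] -/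
theorem I_mul_cos_mul_eq (s : ℂ) :
    I * Complex.cos (π * s / 2) * (1 - qexp s) = Complex.sin (π * s / 2) * (1 + qexp s) := by
  set E : ℂ := cexp (π * s / 2 * I) with hE
  have hF : cexp (-(π * s / 2) * I) = E⁻¹ := by rw [neg_mul, Complex.exp_neg]
  have hq : qexp s = E ^ 2 := by
    rw [qexp, hE, sq, ← Complex.exp_add]
    congr 1
    ring
  have hEF : E * E⁻¹ = 1 := mul_inv_cancel₀ (Complex.exp_ne_zero _)
  rw [Complex.cos, Complex.sin, hF, hq]
  linear_combination (-(I * E)) * hEF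

/-- For `Im s > 0`: `sin(πs/2) ≠ 0` (its zeros are real). [folklore] -/
theorem sin_ne_zero_of_im_pos {s : ℂ} (hs : 0 < s.im) : Complex.sin (π * s / 2) ≠ 0 := by
  intro h
  obtain ⟨k, hk⟩ := Complex.sin_eq_zero_iff.mp h
  have h1 : ((π : ℂ) * s / 2).im = π / 2 * s.im := by
    rw [show (π : ℂ) * s / 2 = ((π / 2 : ℝ) : ℂ) * s by push_cast; ring, Complex.im_ofReal_mul]
  have h2 : ((k : ℂ) * π).im = 0 := by simp
  rw [hk, h2] at h1
  have : s.im = 0 := by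
    rcases mul_eq_zero.mp h1.symm with h3 | h3
    · exact absurd h3 (by positivity)
    · exact h3
  linarith

/-- For `Im s > 0`: `|q| < 1`, so `1 − q ≠ 0` and `1 + q ≠ 0`. [folklore] -/
theorem norm_qexp_lt_one {s : ℂ} (hs : 0 < s.im) : ‖qexp s‖ < 1 := by
  rw [norm_qexp, Real.exp_lt_one_iff]
  nlinarith [Real.pi_pos]

/-- [folklore] -/
theorem one_sub_qexp_ne_zero {s : ℂ} (hs : 0 < s.im) : 1 - qexp s ≠ 0 := by
  intro h
  have : ‖qexp s‖ = 1 := by rw [← sub_eq_zero.mp h]; simp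
  linarith [norm_qexp_lt_one hs]

/-- [folklore] -/
theorem one_add_qexp_ne_zero {s : ℂ} (hs : 0 < s.im) : 1 + qexp s ≠ 0 := by
  intro h
  have : ‖qexp s‖ = 1 := by
    rw [show qexp s = -1 by linear_combination h]
    simp
  linarith [norm_qexp_lt_one hs]

/-- `i cot(πs/2) = (1 + q)/(1 − q)`, `q = e^{iπs}`, for `Im s > 0`. [folklore] -/
theorem I_mul_cot_eq {s : ℂ} (hs : 0 < s.im) :
    I * (Complex.cos (π * s / 2) / Complex.sin (π * s / 2)) = (1 + qexp s) / (1 - qexp s) := by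
  have h1 := sin_ne_zero_of_im_pos hs
  have h2 := one_sub_qexp_ne_zero hs
  have key := I_mul_cos_mul_eq s
  field_simp
  linear_combination key

/-- **"Assume `t > 1`. Then `i cot(πs/2) = 1 + O(e^{−πt})`"**, explicitly: for `t = Im s > 0`,
`|i cot(πs/2) − 1| ≤ 2e^{−πt}/(1 − e^{−πt})`. [cite: Zhang2022LandauSiegel, §2 before (2.4)] -/
theorem norm_I_mul_cot_sub_one_le {s : ℂ} (hs : 0 < s.im) :
    ‖I * (Complex.cos (π * s / 2) / Complex.sin (π * s / 2)) - 1‖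
      ≤ 2 * Real.exp (-π * s.im) / (1 - Real.exp (-π * s.im)) := by
  have h2 := one_sub_qexp_ne_zero hs
  have hq1 := norm_qexp_lt_one hs
  rw [I_mul_cot_eq hs, show (1 + qexp s) / (1 - qexp s) - 1 = 2 * qexp s / (1 - qexp s) by
    field_simp; ring, norm_div, norm_mul, Complex.norm_two, norm_qexp]
  have hden : 1 - Real.exp (-π * s.im) ≤ ‖1 - qexp s‖ := by
    have := norm_sub_norm_le (1 : ℂ) (qexp s)
    rw [norm_one, norm_qexp] at this
    linarith
  have hpos : 0 < 1 - Real.exp (-π * s.im) := by rw [← norm_qexp]; linarith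
  exact div_le_div_of_nonneg_left (by positivity) hpos hden

/-- `e^{−πt} ≤ 1/3` for `t ≥ 1` (`e^π ≥ 1 + π > 3`). [folklore] -/
theorem exp_neg_pi_mul_le {t : ℝ} (ht : 1 ≤ t) : Real.exp (-π * t) ≤ 1 / 3 := by
  have h1 : Real.exp (-π * t) ≤ Real.exp (-π) := Real.exp_le_exp.mpr (by nlinarith [Real.pi_pos])
  have h2 : (3 : ℝ) ≤ Real.exp π := by
    have := Real.add_one_le_exp π
    linarith [Real.pi_gt_three]
  have h3 : Real.exp (-π) ≤ 1 / 3 := by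
    rw [Real.exp_neg, inv_eq_one_div]
    exact one_div_le_one_div_of_le (by norm_num) h2
  exact h1.trans h3

/-- The printed range `t > 1` (here `t ≥ 1`): `|i cot(πs/2) − 1| ≤ 3e^{−πt}`.
[cite: Zhang2022LandauSiegel, §2 before (2.4)] -/
theorem norm_I_mul_cot_sub_one_le' {s : ℂ} (hs : 1 ≤ s.im) :
    ‖I * (Complex.cos (π * s / 2) / Complex.sin (π * s / 2)) - 1‖ ≤ 3 * Real.exp (-π * s.im) := by
  have h := norm_I_mul_cot_sub_one_le (lt_of_lt_of_le one_pos hs)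
  have hq := exp_neg_pi_mul_le hs
  have hpos : 0 < Real.exp (-π * s.im) := Real.exp_pos _
  refine h.trans ?_
  rw [div_le_iff₀ (by linarith)]
  nlinarith

/-! ### §3. (5.5): `ϑ(1−s) = ϑ*(1−s)(1 + O(e^{−πt}))`, and `ϑ(s)ϑ(1−s) = 1` -/

/-- `ϑ*(1−s) = (2π)^{−s}Γ(s)e(−s/4)`, `e(x) = e^{2πix}` (as a function of `s`).
[cite: Zhang2022LandauSiegel, §5 (5.5)] -/
def varthetaStarOneSub (s : ℂ) : ℂ := (2 * π : ℂ) ^ (-s) * Complex.Gamma s * cexp (-(π * s / 2) * I)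

/-- **(5.5) exactly**: `ϑ(1−s) = ϑ*(1−s)·(1 + q)`, `q = e^{iπs}`, `|q| = e^{−πt}` (so
`ϑ(1−s) = ϑ*(1−s)(1 + O(e^{−πt}))` with constant `1`, for every `s`).
[cite: Zhang2022LandauSiegel, §5 (5.5)] -/
theorem vartheta_one_sub_eq_star_mul (s : ℂ) :
    vartheta (1 - s) = varthetaStarOneSub s * (1 + qexp s) := by
  rw [vartheta_one_sub, varthetaStarOneSub, Complex.cos, qexp]
  have hF : cexp (-(π * s / 2) * I) * cexp (π * s / 2 * I) = 1 := by
    rw [← Complex.exp_add]; simp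
  have hq : cexp (π * s * I) = cexp (π * s / 2 * I) * cexp (π * s / 2 * I) := by
    rw [← Complex.exp_add]; congr 1; ring
  rw [hq]
  linear_combination (-((2 * π : ℂ) ^ (-s) * Complex.Gamma s * cexp (π * s / 2 * I))) * hF

/-- **`ϑ(s)ϑ(1−s) = 1`** for `s ∉ ℤ` — Titchmarsh's (2.1.11) `χ(s)χ(1−s) = 1` (reflection
`Γ(s)Γ(1−s) = π/sin(πs)` and `sin(πs) = 2sin(πs/2)cos(πs/2)`). [cite: Titchmarsh1986, §2.1 (2.1.11)] -/
theorem vartheta_mul_vartheta_one_sub {s : ℂ} (hs : Complex.sin (π * s) ≠ 0) :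
    vartheta s * vartheta (1 - s) = 1 := by
  have hπ : (π : ℂ) ≠ 0 := ofReal_ne_zero.mpr Real.pi_ne_zero
  have h2π : (2 * π : ℂ) ≠ 0 := mul_ne_zero two_ne_zero hπ
  have hrefl := Complex.Gamma_mul_Gamma_one_sub s
  have hdup : Complex.sin (π * s) = 2 * Complex.sin (π * s / 2) * Complex.cos (π * s / 2) := by
    rw [← Complex.sin_two_mul]; congr 1; ring
  rw [vartheta, vartheta_one_sub]
  have hpow : (2 * π : ℂ) ^ (s - 1) * (2 * π : ℂ) ^ (-s) = (2 * π : ℂ)⁻¹ := by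
    rw [← cpow_add _ _ h2π, show s - 1 + -s = (-1 : ℂ) by ring, cpow_neg_one]
  calc 2 * (2 * π : ℂ) ^ (s - 1) * Complex.Gamma (1 - s) * Complex.sin (π * s / 2)
        * (2 * (2 * π : ℂ) ^ (-s) * Complex.Gamma s * Complex.cos (π * s / 2))
      = 2 * ((2 * π : ℂ) ^ (s - 1) * (2 * π : ℂ) ^ (-s))
          * (Complex.Gamma s * Complex.Gamma (1 - s))
          * (2 * Complex.sin (π * s / 2) * Complex.cos (π * s / 2)) := by ring
    _ = 2 * (2 * π : ℂ)⁻¹ * (π / Complex.sin (π * s)) * Complex.sin (π * s) := by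
          rw [hpow, hrefl, ← hdup]
    _ = 1 := by field_simp

/-- `ϑ(s) ≠ 0` for `s ∉ ℤ`. [folklore] -/
theorem vartheta_ne_zero {s : ℂ} (hs : Complex.sin (π * s) ≠ 0) : vartheta s ≠ 0 := by
  intro h
  have := vartheta_mul_vartheta_one_sub hs
  rw [h, zero_mul] at this
  exact zero_ne_one this

/-! ### §4. `Z(s,θ)` and (2.4), (2.5) -/

variable {k : ℕ} [NeZero k]

/-- The Gauss sum `τ(θ) = ∑_{a mod k} θ(a)e(a/k)` (Mathlib's `gaussSum θ stdAddChar`).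
[cite: Zhang2022LandauSiegel, §2 (2.2)] -/
abbrev tau (θ : DirichletCharacter ℂ k) : ℂ := gaussSum θ (ZMod.stdAddChar (N := k))

open scoped Classical in
/-- **`Z(s,θ)` as printed** (the factor of the functional equation (2.2)):
`τ(θ)π^{s−1/2}k^{−s}Γ((1−s)/2)Γ(s/2)⁻¹` for even `θ`, `−iτ(θ)π^{s−1/2}k^{−s}Γ((2−s)/2)Γ((1+s)/2)⁻¹`
for odd `θ`. [cite: Zhang2022LandauSiegel, §2 (2.2)] -/
def Zfac (θ : DirichletCharacter ℂ k) (s : ℂ) : ℂ :=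
  if θ.Even then
    tau θ * (π : ℂ) ^ (s - 1 / 2) * (k : ℂ) ^ (-s)
      * Complex.Gamma ((1 - s) / 2) * (Complex.Gamma (s / 2))⁻¹
  else
    -I * tau θ * (π : ℂ) ^ (s - 1 / 2) * (k : ℂ) ^ (-s)
      * Complex.Gamma ((2 - s) / 2) * (Complex.Gamma ((1 + s) / 2))⁻¹

open scoped Classical in
/-- The (2.4) correction factor: `r = 0` for even `θ`, `r = i cot(πs/2) − 1` for odd `θ`.
[cite: Zhang2022LandauSiegel, §2 (2.4)] -/
def corr (θ : DirichletCharacter ℂ k) (s : ℂ) : ℂ :=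
  if θ.Even then 0 else I * (Complex.cos (π * s / 2) / Complex.sin (π * s / 2)) - 1

/-- **(2.4), even case, exactly**: `Z(s,θ) = θ(−1)τ(θ)k^{−s}ϑ(s)` ("the `O(e^{−πt})` term being
identically zero in case `θ(−1) = 1`"), for `s ≠ 2, 4, 6, …`.
[cite: Zhang2022LandauSiegel, §2 (2.4)] -/
theorem Zfac_eq_even {θ : DirichletCharacter ℂ k} (hθ : θ.Even) {s : ℂ}
    (hs : ∀ n : ℕ, s ≠ 2 * n + 2) :
    Zfac θ s = θ (-1) * tau θ * (k : ℂ) ^ (-s) * vartheta s := by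
  rw [Zfac, if_pos hθ, ← gammaQuotient_even_eq hs, show θ (-1) = 1 from hθ]
  ring

/-- **(2.4), odd case, exactly**: `Z(s,θ) = θ(−1)τ(θ)k^{−s}ϑ(s)·(i cot(πs/2))`, for
`s ≠ 1, 2, 3, …` with `sin(πs/2) ≠ 0`. [cite: Zhang2022LandauSiegel, §2 (2.4)] -/
theorem Zfac_eq_odd {θ : DirichletCharacter ℂ k} (hθ : θ.Odd) {s : ℂ}
    (hs : ∀ n : ℕ, s ≠ n + 1) (hsin : Complex.sin (π * s / 2) ≠ 0) :
    Zfac θ s = θ (-1) * tau θ * (k : ℂ) ^ (-s) * vartheta s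
      * (I * (Complex.cos (π * s / 2) / Complex.sin (π * s / 2))) := by
  have hne : ¬ θ.Even := by
    intro h
    have h1 : θ (-1) = 1 := h
    have h2 : θ (-1) = -1 := hθ
    rw [h1] at h2
    norm_num at h2
  rw [Zfac, if_neg hne, show θ (-1) = -1 from hθ]
  have hg := gammaQuotient_odd_eq_cot hs hsin
  calc -I * tau θ * (π : ℂ) ^ (s - 1 / 2) * (k : ℂ) ^ (-s)
        * Complex.Gamma ((2 - s) / 2) * (Complex.Gamma ((1 + s) / 2))⁻¹
      = -I * tau θ * (k : ℂ) ^ (-s) * ((π : ℂ) ^ (s - 1 / 2)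
        * Complex.Gamma ((2 - s) / 2) * (Complex.Gamma ((1 + s) / 2))⁻¹) := by ring
    _ = -I * tau θ * (k : ℂ) ^ (-s)
        * (vartheta s * (Complex.cos (π * s / 2) / Complex.sin (π * s / 2))) := by rw [hg]
    _ = -1 * tau θ * (k : ℂ) ^ (-s) * vartheta s
        * (I * (Complex.cos (π * s / 2) / Complex.sin (π * s / 2))) := by ring

/-- **(2.4) uniformly, exactly**: `Z(s,θ) = θ(−1)τ(θ)k^{−s}ϑ(s)(1 + r)` with `r = corr θ s`, for
`t = Im s > 0`. [cite: Zhang2022LandauSiegel, §2 (2.4)] -/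
theorem Zfac_eq (θ : DirichletCharacter ℂ k) {s : ℂ} (hs : 0 < s.im) :
    Zfac θ s = θ (-1) * tau θ * (k : ℂ) ^ (-s) * vartheta s * (1 + corr θ s) := by
  have hs1 : ∀ n : ℕ, s ≠ n + 1 := by
    intro n h
    have := congrArg Complex.im h
    simp at this
    linarith
  have hs2 : ∀ n : ℕ, s ≠ 2 * n + 2 := by
    intro n h
    have := congrArg Complex.im h
    simp at this
    linarith
  rcases θ.even_or_odd with hθ | hθ
  · rw [Zfac_eq_even hθ hs2, corr, if_pos hθ]
    ring
  · have hne : ¬ θ.Even := by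
      intro h
      have h1 : θ (-1) = 1 := h
      have h2 : θ (-1) = -1 := hθ
      rw [h1] at h2
      norm_num at h2
    rw [Zfac_eq_odd hθ hs1 (sin_ne_zero_of_im_pos hs), corr, if_neg hne]
    ring

omit [NeZero k] in
/-- **The `O(e^{−πt})` of (2.4)**: `|r| ≤ 3e^{−πt}` for `t ≥ 1`, and `r = 0` for even `θ`.
[cite: Zhang2022LandauSiegel, §2 (2.4)] -/
theorem norm_corr_le (θ : DirichletCharacter ℂ k) {s : ℂ} (hs : 1 ≤ s.im) :
    ‖corr θ s‖ ≤ 3 * Real.exp (-π * s.im) := by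
  unfold corr
  split_ifs with h
  · simp only [norm_zero]
    positivity
  · exact norm_I_mul_cot_sub_one_le' hs

omit [NeZero k] in
/-- [cite: Zhang2022LandauSiegel, §2 (2.4) ("identically zero in case `θ(−1) = 1`")] -/
theorem corr_eq_zero_of_even {θ : DirichletCharacter ℂ k} (hθ : θ.Even) (s : ℂ) : corr θ s = 0 := by
  rw [corr, if_pos hθ]

omit [NeZero k] in
/-- `1 + r ≠ 0` for `Im s > 0`. [folklore] -/
theorem one_add_corr_ne_zero (θ : DirichletCharacter ℂ k) {s : ℂ} (hs : 0 < s.im) :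
    1 + corr θ s ≠ 0 := by
  unfold corr
  split_ifs with h
  · norm_num
  · rw [add_sub_cancel, I_mul_cot_eq hs]
    exact div_ne_zero (one_add_qexp_ne_zero hs) (one_sub_qexp_ne_zero hs)

/-- **(2.5) exactly**: for a primitive `θ` mod `k` and `Im s > 0`,
`Z(s,θ)⁻¹ = τ(θ̄)k^{s−1}ϑ(1−s)·(1+r)⁻¹` (`θ̄ = θ⁻¹`; uses `τ(θ)τ(θ̄) = θ(−1)k` and
`ϑ(s)ϑ(1−s) = 1`). [cite: Zhang2022LandauSiegel, §2 (2.5)] -/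
theorem Zfac_inv_eq {θ : DirichletCharacter ℂ k} (hθ : θ.IsPrimitive) {s : ℂ} (hs : 0 < s.im) :
    (Zfac θ s)⁻¹ = tau θ⁻¹ * (k : ℂ) ^ (s - 1) * vartheta (1 - s) * (1 + corr θ s)⁻¹ := by
  have hk : (k : ℂ) ≠ 0 := Nat.cast_ne_zero.mpr (NeZero.ne k)
  have hgauss : tau θ * tau θ⁻¹ = θ (-1) * k :=
    Literature.NumberTheory.LFunctions.gaussSum_mul_gaussSum_inv θ hθ
  have hsq : θ (-1) * θ (-1) = 1 := by
    rw [← map_mul, neg_mul_neg, one_mul, map_one]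
  have hϑ : vartheta s * vartheta (1 - s) = 1 :=
    vartheta_mul_vartheta_one_sub (ChiStirling.sin_pi_mul_ne_zero hs.ne')
  have hr : 1 + corr θ s ≠ 0 := one_add_corr_ne_zero θ hs
  have hpow : (k : ℂ) ^ (-s) * (k : ℂ) ^ (s - 1) = (k : ℂ)⁻¹ := by
    rw [← cpow_add _ _ hk, show -s + (s - 1) = (-1 : ℂ) by ring, cpow_neg_one]
  rw [Zfac_eq θ hs]
  symm
  apply eq_inv_of_mul_eq_one_left
  calc tau θ⁻¹ * (k : ℂ) ^ (s - 1) * vartheta (1 - s) * (1 + corr θ s)⁻¹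
        * (θ (-1) * tau θ * (k : ℂ) ^ (-s) * vartheta s * (1 + corr θ s))
      = θ (-1) * (tau θ * tau θ⁻¹) * ((k : ℂ) ^ (-s) * (k : ℂ) ^ (s - 1))
          * (vartheta s * vartheta (1 - s)) * ((1 + corr θ s)⁻¹ * (1 + corr θ s)) := by ring
    _ = θ (-1) * (θ (-1) * k) * (k : ℂ)⁻¹ * 1 * 1 := by
          rw [hgauss, hpow, hϑ, inv_mul_cancel₀ hr]
    _ = 1 := by
          calc θ (-1) * (θ (-1) * k) * (k : ℂ)⁻¹ * 1 * 1
              = (θ (-1) * θ (-1)) * ((k : ℂ) * (k : ℂ)⁻¹) := by ring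
            _ = 1 := by rw [hsq, mul_inv_cancel₀ hk, one_mul]

omit [NeZero k] in
/-- **The `O(e^{−πt})` of (2.5)**: `|(1+r)⁻¹ − 1| ≤ 6e^{−πt}` for `t ≥ 1`.
[cite: Zhang2022LandauSiegel, §2 (2.5)] -/
theorem norm_inv_one_add_corr_sub_one_le (θ : DirichletCharacter ℂ k) {s : ℂ} (hs : 1 ≤ s.im) :
    ‖(1 + corr θ s)⁻¹ - 1‖ ≤ 6 * Real.exp (-π * s.im) := by
  have h1 := norm_corr_le θ hs
  have h2 := exp_neg_pi_mul_le hs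
  have h4 : rexp (-π * s.im) ≤ 1 / 6 := by
    -- for `t ≥ 1`: `e^{−πt} ≤ e^{−π} ≤ 1/(1+π) < 1/4`; we only need `3e^{−πt} ≤ 1/2`
    have h5 : Real.exp (-π * s.im) ≤ Real.exp (-π) :=
      Real.exp_le_exp.mpr (by nlinarith [Real.pi_pos])
    have h6 : (6 : ℝ) ≤ Real.exp π := by
      have := Real.add_one_le_exp (π - 1)
      have h7 : Real.exp (π - 1) * Real.exp 1 = Real.exp π := by
        rw [← Real.exp_add]; ring_nf
      have h8 : (2 : ℝ) ≤ Real.exp 1 := by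
        have := Real.add_one_le_exp (1 : ℝ); linarith
      have h10 : π * 2 ≤ Real.exp (π - 1) * Real.exp 1 :=
        mul_le_mul (by linarith) h8 (by norm_num) (Real.exp_pos _).le
      rw [h7] at h10
      linarith [Real.pi_gt_three]
    have h9 : Real.exp (-π) ≤ 1 / 6 := by
      rw [Real.exp_neg, inv_eq_one_div]
      exact one_div_le_one_div_of_le (by norm_num) h6
    exact h5.trans h9
  have h3 : ‖corr θ s‖ ≤ 1 / 2 := by linarith
  -- `|(1+r)⁻¹ − 1| = |r|/|1+r| ≤ 2|r|` (cf. `Loewner.norm_inv_one_add_sub_one_le` in the tree)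
  set r := corr θ s with hr
  have h5 : 1 / 2 ≤ ‖1 + r‖ := by
    have := norm_sub_norm_le (1 : ℂ) (-r)
    rw [norm_one, norm_neg, sub_neg_eq_add] at this
    linarith
  have hne : 1 + r ≠ 0 := by
    intro h; rw [h, norm_zero] at h5; linarith
  rw [show (1 + r)⁻¹ - 1 = -r / (1 + r) by field_simp; ring, norm_div, norm_neg,
    div_le_iff₀ (by linarith)]
  nlinarith [norm_nonneg r]

/-! ### §5. Lemma 5.1's Stirling step (appended): `Z′/Z(s,θ) = −log k + ϑ′/ϑ(s) + O(e^{−πt})` and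
`ϑ′/ϑ(σ+it) = −log(t/2π) + O(1/t)`

Zhang, proof of Lemma 5.1 [§5, p. 10]: "By (2.6) [sic; (2.4)] and the Stirling formula,
`Z′/Z(s+w′,ψ) = −log p + ϑ′/ϑ(s+w′) + O(ε) = −log(pt/2π) + O(1/t₀)`." Both equalities are made
exact / explicit here: the first from (2.4) exactly (`logDeriv_Zfac_eq`: the `O(ε)` is `0` for even
`θ` and `−π/sin(πs)`, of size `≤ 4πe^{−πt}`, for odd `θ`), the second from the tree's
`Literature.NumberTheory.LFunctions.norm_logDeriv_rsChi_add_log_le` (`χ′/χ = −log(t/2π) + O(1/t)`,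
Montgomery–Vaughan (10.35) + Thm C.1) via `ϑ = χ` (`norm_logDeriv_vartheta_add_log_le`). -/

open Filter Topology

omit [NeZero k] in
/-- Near a point off the real axis, Zhang's `ϑ` IS the tree's `χ`. [folklore] -/
theorem vartheta_eventuallyEq_rsChi {s : ℂ} (hs : s.im ≠ 0) :
    vartheta =ᶠ[𝓝 s] SiegelIntegral.rsChi := by
  have ho : IsOpen {z : ℂ | z.im ≠ 0} := isOpen_ne_fun Complex.continuous_im continuous_const
  filter_upwards [ho.mem_nhds hs] with z hz using vartheta_eq_rsChi hz

omit [NeZero k] in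
/-- `ϑ` is differentiable off the real axis. [folklore] -/
theorem differentiableAt_vartheta {s : ℂ} (hs : s.im ≠ 0) : DifferentiableAt ℂ vartheta s :=
  (vartheta_eventuallyEq_rsChi hs).differentiableAt_iff.mpr
    (SiegelIntegral.differentiableAt_rsChi_of_im_ne_zero hs)

omit [NeZero k] in
/-- `ϑ′/ϑ = χ′/χ` off the real axis. [folklore] -/
theorem logDeriv_vartheta_eq {s : ℂ} (hs : s.im ≠ 0) :
    logDeriv vartheta s = logDeriv SiegelIntegral.rsChi s := by
  rw [logDeriv_apply, logDeriv_apply, (vartheta_eventuallyEq_rsChi hs).deriv_eq, vartheta_eq_rsChi hs]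

omit [NeZero k] in
/-- **"By the Stirling formula": `ϑ′/ϑ(σ+it) = −log(t/2π) + O(1/t)`** — for `1 ≤ A`, `0 < σ ≤ A`,
`t ≥ 2A`: `‖ϑ′/ϑ(σ+it) + log(t/2π)‖ ≤ (2A+3)/t`.
[cite: Zhang2022LandauSiegel, §5, proof of Lemma 5.1] [cite: MontgomeryVaughan2007, Ch. 10 (10.35); App. C Thm C.1 (C.17)] -/
theorem norm_logDeriv_vartheta_add_log_le {A σ t : ℝ} (hA : 1 ≤ A) (hσ0 : 0 < σ) (hσA : σ ≤ A)
    (ht : 2 * A ≤ t) :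
    ‖logDeriv vartheta (σ + t * I) + Real.log (t / (2 * π))‖ ≤ (2 * A + 3) / t := by
  have him' : ((σ : ℂ) + t * I).im = t := by simp
  have him : ((σ : ℂ) + t * I).im ≠ 0 := by
    rw [him']
    exact ne_of_gt (show (0 : ℝ) < t by linarith)
  rw [logDeriv_vartheta_eq him]
  exact norm_logDeriv_rsChi_add_log_le hA hσ0 hσA ht

/-- `τ(θ) ≠ 0` for primitive `θ` (from `τ(θ)τ(θ̄) = θ(−1)k`). [folklore] -/
theorem tau_ne_zero {θ : DirichletCharacter ℂ k} (hθ : θ.IsPrimitive) : tau θ ≠ 0 := by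
  intro h
  have hg := Literature.NumberTheory.LFunctions.gaussSum_mul_gaussSum_inv θ hθ
  have hk : (k : ℂ) ≠ 0 := Nat.cast_ne_zero.mpr (NeZero.ne k)
  have hsq : θ (-1) * θ (-1) = 1 := by
    rw [← map_mul, neg_mul_neg, one_mul, map_one]
  have h1 : θ (-1) ≠ 0 := by
    intro h0
    rw [h0, zero_mul] at hsq
    exact zero_ne_one hsq
  have : tau θ * tau θ⁻¹ = 0 := by rw [h, zero_mul]
  rw [this] at hg
  exact mul_ne_zero h1 hk hg.symm

/-- `d/dz k^{−z} = −(log k) k^{−z}`, so `logDeriv (k^{−·}) = −log k`. [folklore] -/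
theorem logDeriv_cpow_neg (s : ℂ) :
    logDeriv (fun z : ℂ => (k : ℂ) ^ (-z)) s = -Real.log k := by
  have hk : (k : ℂ) ≠ 0 := Nat.cast_ne_zero.mpr (NeZero.ne k)
  have hd : HasDerivAt (fun z : ℂ => (k : ℂ) ^ (-z)) ((k : ℂ) ^ (-s) * Complex.log k * (-1)) s :=
    (hasStrictDerivAt_const_cpow (Or.inl hk)).hasDerivAt.comp s (hasDerivAt_neg s)
  have hne : (k : ℂ) ^ (-s) ≠ 0 := by
    rw [Ne, cpow_eq_zero_iff, not_and_or]
    exact Or.inl hk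
  rw [logDeriv_apply, hd.deriv, ← Complex.natCast_log]
  field_simp

/-- The logarithmic derivative of the odd-case correction `i cot(πs/2)` is `−π/sin(πs)`.
[folklore] -/
theorem logDeriv_I_mul_cot {s : ℂ} (hsin : Complex.sin (π * s / 2) ≠ 0)
    (hcos : Complex.cos (π * s / 2) ≠ 0) :
    logDeriv (fun z : ℂ => I * (Complex.cos (π * z / 2) / Complex.sin (π * z / 2))) s
      = -π / Complex.sin (π * s) := by
  have h1 : HasDerivAt (fun z : ℂ => π * z / 2) (π / 2) s := by
    simpa using ((hasDerivAt_id s).const_mul (π : ℂ)).div_const 2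
  have hc : HasDerivAt (fun z : ℂ => Complex.cos (π * z / 2))
      (-Complex.sin (π * s / 2) * (π / 2)) s := by
    exact (Complex.hasDerivAt_cos (π * s / 2)).comp s h1
  have hs' : HasDerivAt (fun z : ℂ => Complex.sin (π * z / 2))
      (Complex.cos (π * s / 2) * (π / 2)) s := by
    exact (Complex.hasDerivAt_sin (π * s / 2)).comp s h1
  have hcot : HasDerivAt (fun z : ℂ => Complex.cos (π * z / 2) / Complex.sin (π * z / 2))
      ((-Complex.sin (π * s / 2) * (π / 2) * Complex.sin (π * s / 2)
        - Complex.cos (π * s / 2) * (Complex.cos (π * s / 2) * (π / 2)))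
        / Complex.sin (π * s / 2) ^ 2) s := by
    exact hc.div hs' hsin
  rw [logDeriv_const_mul s I I_ne_zero, logDeriv_apply, hcot.deriv]
  have hN : -Complex.sin (π * s / 2) * (π / 2) * Complex.sin (π * s / 2)
        - Complex.cos (π * s / 2) * (Complex.cos (π * s / 2) * (π / 2)) = -(π / 2) := by
    linear_combination (-(π : ℂ) / 2) * Complex.sin_sq_add_cos_sq (π * s / 2)
  have hdup : Complex.sin (π * s) = 2 * Complex.sin (π * s / 2) * Complex.cos (π * s / 2) := by
    rw [← Complex.sin_two_mul]; congr 1; ring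
  rw [hN, hdup]
  field_simp

/-- `|π/sin(πs)| ≤ 2π/(e^{πt} − e^{−πt})` for `t = Im s > 0` (`sin(πs) = (q⁻¹ − q)i/2`, `|q| = e^{−πt}`).
[folklore] -/
theorem norm_pi_div_sin_le {s : ℂ} (hs : 0 < s.im) :
    ‖-π / Complex.sin (π * s)‖ ≤ 2 * π / (Real.exp (π * s.im) - Real.exp (-π * s.im)) := by
  have hq : ‖qexp s‖ = Real.exp (-π * s.im) := norm_qexp s
  have hqinv : ‖(qexp s)⁻¹‖ = Real.exp (π * s.im) := by
    rw [norm_inv, hq, ← Real.exp_neg]; ring_nf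
  have hsin : Complex.sin (π * s) = ((qexp s)⁻¹ - qexp s) * I / 2 := by
    rw [Complex.sin, qexp, ← Complex.exp_neg, neg_mul]
  have hlow : (Real.exp (π * s.im) - Real.exp (-π * s.im)) / 2 ≤ ‖Complex.sin (π * s)‖ := by
    rw [hsin, norm_div, norm_mul, Complex.norm_I, mul_one, Complex.norm_two]
    have := norm_sub_norm_le (qexp s)⁻¹ (qexp s)
    rw [hqinv, hq] at this
    linarith
  have hpos : 0 < Real.exp (π * s.im) - Real.exp (-π * s.im) := by
    have : Real.exp (-π * s.im) < Real.exp (π * s.im) := Real.exp_lt_exp.mpr (by nlinarith [Real.pi_pos])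
    linarith
  have hsin0 : Complex.sin (π * s) ≠ 0 := by
    intro h; rw [h, norm_zero] at hlow; linarith
  rw [norm_div, norm_neg, Complex.norm_real, Real.norm_eq_abs, abs_of_pos Real.pi_pos,
    div_le_div_iff₀ (norm_pos_iff.mpr hsin0) hpos]
  nlinarith [Real.pi_pos]

open scoped Classical in
/-- The `O(ε)` of Lemma 5.1's first display: `E = 0` for even `θ`, `E = −π/sin(πs)` for odd `θ`.
[cite: Zhang2022LandauSiegel, §5, proof of Lemma 5.1] -/
def logDerivCorr (θ : DirichletCharacter ℂ k) (s : ℂ) : ℂ :=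
  if θ.Even then 0 else -π / Complex.sin (π * s)

/-- **Lemma 5.1's first step, exactly**: for primitive `θ` mod `k` and `Im s > 0`,
`Z′/Z(s,θ) = −log k + ϑ′/ϑ(s) + E`, `E = logDerivCorr θ s` (`= 0` for even `θ`, `= −π/sin(πs)` for
odd `θ`; the source's "`= −log p + ϑ′/ϑ + O(ε)`" with `k = p`).
[cite: Zhang2022LandauSiegel, §5, proof of Lemma 5.1] -/
theorem logDeriv_Zfac_eq {θ : DirichletCharacter ℂ k} (hθ : θ.IsPrimitive) {s : ℂ} (hs : 0 < s.im) :
    logDeriv (Zfac θ) s = -Real.log k + logDeriv vartheta s + logDerivCorr θ s := by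
  have him : s.im ≠ 0 := hs.ne'
  have hk : (k : ℂ) ≠ 0 := Nat.cast_ne_zero.mpr (NeZero.ne k)
  have hC : θ (-1) * tau θ ≠ 0 := by
    refine mul_ne_zero ?_ (tau_ne_zero hθ)
    intro h0
    have hsq : θ (-1) * θ (-1) = 1 := by rw [← map_mul, neg_mul_neg, one_mul, map_one]
    rw [h0, zero_mul] at hsq
    exact zero_ne_one hsq
  have hkpow : (k : ℂ) ^ (-s) ≠ 0 := by
    rw [Ne, cpow_eq_zero_iff, not_and_or]; exact Or.inl hk
  have hϑ : vartheta s ≠ 0 := vartheta_ne_zero (ChiStirling.sin_pi_mul_ne_zero him)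
  have hkd : DifferentiableAt ℂ (fun z : ℂ => (k : ℂ) ^ (-z)) s :=
    ((hasStrictDerivAt_const_cpow (Or.inl hk)).hasDerivAt.comp s (hasDerivAt_neg s)).differentiableAt
  have hϑd : DifferentiableAt ℂ vartheta s := differentiableAt_vartheta him
  -- the open set `{Im z > 0}` on which (2.4) holds pointwise
  have ho : IsOpen {z : ℂ | 0 < z.im} := isOpen_lt continuous_const Complex.continuous_im
  have hmem : {z : ℂ | 0 < z.im} ∈ 𝓝 s := ho.mem_nhds hs
  have main : logDeriv (fun z : ℂ => (k : ℂ) ^ (-z) * vartheta z) s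
      = -Real.log k + logDeriv vartheta s := by
    rw [logDeriv_mul (f := fun z : ℂ => (k : ℂ) ^ (-z)) (g := vartheta) s hkpow hϑ hkd hϑd,
      logDeriv_cpow_neg]
  rcases θ.even_or_odd with hev | hodd
  · -- even: `Z(z,θ) = θ(−1)τ(θ) · (k^{−z}ϑ(z))` near `s`
    have hE : Zfac θ =ᶠ[𝓝 s] fun z => (θ (-1) * tau θ) * ((k : ℂ) ^ (-z) * vartheta z) := by
      filter_upwards [hmem] with z hz
      have hz2 : ∀ n : ℕ, z ≠ 2 * n + 2 := by
        intro n h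
        have := congrArg Complex.im h
        simp at this
        exact (ne_of_gt hz) this
      rw [Zfac_eq_even hev hz2]
      ring
    rw [logDerivCorr, if_pos hev, add_zero, logDeriv_apply, hE.deriv_eq, hE.self_of_nhds,
      ← logDeriv_apply, logDeriv_const_mul s _ hC, main]
  · -- odd: one more factor `i cot(πz/2)`
    have hne : ¬ θ.Even := by
      intro h
      have h1 : θ (-1) = 1 := h
      have h2 : θ (-1) = -1 := hodd
      rw [h1] at h2
      norm_num at h2
    have hsin := sin_ne_zero_of_im_pos hs
    have hcos : Complex.cos (π * s / 2) ≠ 0 :=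
      SiegelIntegral.cos_pi_mul_div_two_ne_zero_of_im_ne_zero him
    have hcot0 : I * (Complex.cos (π * s / 2) / Complex.sin (π * s / 2)) ≠ 0 :=
      mul_ne_zero I_ne_zero (div_ne_zero hcos hsin)
    have h1 : HasDerivAt (fun z : ℂ => π * z / 2) (π / 2) s := by
      simpa using ((hasDerivAt_id s).const_mul (π : ℂ)).div_const 2
    have hcotd : DifferentiableAt ℂ
        (fun z : ℂ => I * (Complex.cos (π * z / 2) / Complex.sin (π * z / 2))) s := by
      have hc : DifferentiableAt ℂ (fun z : ℂ => Complex.cos (π * z / 2)) s := by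
        exact ((Complex.hasDerivAt_cos (π * s / 2)).comp s h1).differentiableAt
      have hs' : DifferentiableAt ℂ (fun z : ℂ => Complex.sin (π * z / 2)) s := by
        exact ((Complex.hasDerivAt_sin (π * s / 2)).comp s h1).differentiableAt
      have hq : DifferentiableAt ℂ
          (fun z : ℂ => Complex.cos (π * z / 2) / Complex.sin (π * z / 2)) s := hc.div hs' hsin
      exact (differentiableAt_const I).mul hq
    have hE : Zfac θ =ᶠ[𝓝 s] fun z => (θ (-1) * tau θ)
        * (((k : ℂ) ^ (-z) * vartheta z)
          * (I * (Complex.cos (π * z / 2) / Complex.sin (π * z / 2)))) := by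
      filter_upwards [hmem] with z hz
      have hz1 : ∀ n : ℕ, z ≠ n + 1 := by
        intro n h
        have := congrArg Complex.im h
        simp at this
        exact (ne_of_gt hz) this
      rw [Zfac_eq_odd hodd hz1 (sin_ne_zero_of_im_pos hz)]
      ring
    rw [logDerivCorr, if_neg hne, logDeriv_apply, hE.deriv_eq, hE.self_of_nhds, ← logDeriv_apply,
      logDeriv_const_mul s _ hC,
      logDeriv_mul (f := fun z : ℂ => (k : ℂ) ^ (-z) * vartheta z)
        (g := fun z : ℂ => I * (Complex.cos (π * z / 2) / Complex.sin (π * z / 2)))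
        s (mul_ne_zero hkpow hϑ) hcot0 (hkd.mul hϑd) hcotd,
      main, logDeriv_I_mul_cot hsin hcos]

omit [NeZero k] in
/-- **The `O(ε)`**: `‖E‖ ≤ 2π/(e^{πt} − e^{−πt})` (`= 0` for even `θ`), `t = Im s > 0`.
[cite: Zhang2022LandauSiegel, §5, proof of Lemma 5.1] -/
theorem norm_logDerivCorr_le (θ : DirichletCharacter ℂ k) {s : ℂ} (hs : 0 < s.im) :
    ‖logDerivCorr θ s‖ ≤ 2 * π / (Real.exp (π * s.im) - Real.exp (-π * s.im)) := by
  unfold logDerivCorr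
  split_ifs with h
  · rw [norm_zero]
    have : Real.exp (-π * s.im) < Real.exp (π * s.im) := Real.exp_lt_exp.mpr (by nlinarith [Real.pi_pos])
    have hpos : 0 < Real.exp (π * s.im) - Real.exp (-π * s.im) := by linarith
    positivity
  · exact norm_pi_div_sin_le hs

end Literature.NumberTheory.LFunctions.Zhang2022.GammaFactor
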